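import Mathlib.RepresentationTheory.Homological.ContCohomology.Functoriality
import Mathlib.GroupTheory.GroupAction.ConjAct
import Mathlib.Topology.Algebra.Group.Quotient
import Literature.AnabelianGeometry.AbsoluteAnabelian.AbsTopIII.CurveModel
import Literature.AnabelianGeometry.AbsoluteAnabelian.AbsTopIII.KummerFaithful
import HarnessLib

/-!
# [AbsTopIII] §1: the geometric cyclotome `M_X` group-theoretically, `H¹(Π_U, M_X)`, Prop. 1.6

Mochizuki, *Topics in Absolute Anabelian Geometry III*, §1, Prop. 1.4 (ii) p. 31 and Prop. 1.6
pp. 34–35 (manuscript pages, lit key `paper:url-5493eb38cbb7`).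

Prop. 1.4 (ii) exhibits the cyclotome `M_X` (≅ `Ẑ(1)` ≅ `I_x`) inside the "maximal cuspidally
central quotient" `Δ^{c-cn}_{U_x}` of `Δ_{U_x}`: with `N := Ker(Δ_{U_x} ↠ Δ_X)` and
`Δ^{c-cn}_{U_x} := Δ_{U_x}/[N, Δ_{U_x}]⁻`, the image of `N` is a CENTRAL, hence abelian, normal
subgroup on which `Π_{U_x}` acts by conjugation (through the cyclotomic character).  This gives a
purely group-theoretic model of the `Π`-module `M_X`:

* `cyclotomeQuotient q` = `Π_{U_x}/[N, Δ]⁻` and `geomCyclotome q ≤ cyclotomeQuotient q` = the image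
  of `N` (REAL, from a homomorphism of extensions `q : Π_{U_x} → Π_X`), proved normal and
  commutative;
* `conjRep A` = the continuous `ℤ`-linear representation of a topological group on (the additive
  group of) an abelian normal subgroup `A` by conjugation, as a Mathlib `ContRepresentation`, and
  `geomCyclotomeRep r q` = the representation of `Π_U` on `M_X` through `Π_U → Π_{U_x} ↠ Π_{U_x}/[N,Δ]⁻`;
* `geomCyclotomeH1 r q` := Mathlib's `continuousCohomology 1` of it — a REAL `H¹(Π_U, M_X)` (topological
  `ℤ`-module), with restriction to subgroups via `ContinuousCohomology.map`;
* Prop. 1.6 (i) and the part of (iii) statable without the Picard schemes, as facts RELATIVE TO a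
  model `M : KummerCurveModel` (a `CurveModel` extended by the regular units `Γ(U, 𝒪_U^×)` and
  the Kummer map `κ_U`, which are geometric data).  Prop. 1.6 (ii) (sections `t_D : G_k → Π_{J^d}`
  and principal divisors) and Prop. 1.8 (the subgroup `P_U`, which needs the synchronizations
  `I_z ≅ M_X` of Prop. 1.4 (ii) for ALL cusps) remain recorded-not-typed (see `Reconstruction.lean`).
-/

noncomputable section

open CategoryTheory
open scoped Classical Pointwise IsMulCommutative

namespace Literature.AnabelianGeometry.AbsoluteAnabelian.AbsTopIII

universe u

/-! ### Conjugation representation on an abelian normal subgroup -/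

section ConjRep

variable {G : Type u} [Group G] [TopologicalSpace G] [IsTopologicalGroup G]
  (A : Subgroup G) [A.Normal] [IsMulCommutative A]

/-- Conjugation by `g` on the abelian normal subgroup `A`, as an additive homomorphism of
`Additive A`. [cite: MochizukiAbsTopIII2015, Prop 1.4 (ii) p.31] -/
def conjAddHom (g : G) : Additive A →+ Additive A :=
  MonoidHom.toAdditive (MulAut.conjNormal g : MulAut A).toMonoidHom

omit [TopologicalSpace G] [IsTopologicalGroup G] [IsMulCommutative A] in
/-- `conjAddHom g a = g a g⁻¹`. [cite: MochizukiAbsTopIII2015, Prop 1.4 (ii) p.31] -/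
theorem conjAddHom_apply (g : G) (a : Additive A) :
    conjAddHom A g a = Additive.ofMul (MulAut.conjNormal g (Additive.toMul a)) :=
  rfl

omit [IsMulCommutative A] in
/-- Conjugation by a fixed element is continuous on a normal subgroup.
[cite: MochizukiAbsTopIII2015, Prop 1.4 (ii) p.31] -/
theorem continuous_conjAddHom (g : G) : Continuous (conjAddHom A g) := by
  change Continuous fun a : A => MulAut.conjNormal g a
  exact continuous_induced_rng.2 (by
    simp only [Function.comp_def, MulAut.conjNormal_apply]
    fun_prop)

/-- Conjugation by `g` as a continuous `ℤ`-linear endomorphism of `Additive A`.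
[cite: MochizukiAbsTopIII2015, Prop 1.4 (ii) p.31] -/
def conjCLM (g : G) : Additive A →L[ℤ] Additive A :=
  ⟨(conjAddHom A g).toIntLinearMap, continuous_conjAddHom A g⟩

/-- `conjCLM g a = g a g⁻¹`. [cite: MochizukiAbsTopIII2015, Prop 1.4 (ii) p.31] -/
@[simp] theorem conjCLM_apply (g : G) (a : Additive A) :
    conjCLM A g a = Additive.ofMul (MulAut.conjNormal g (Additive.toMul a)) :=
  rfl

/-- The conjugation representation of `G` on the abelian normal subgroup `A` (written
additively), as a Mathlib continuous representation over `ℤ`.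
[cite: MochizukiAbsTopIII2015, Prop 1.4 (ii) p.31] -/
def conjRep : ContRepresentation ℤ G (Additive A) :=
  .ofMonoidHom
    { toFun := conjCLM A
      map_one' := by
        ext a
        simp
      map_mul' := fun g h => by
        ext a
        simp [map_mul] }

end ConjRep

/-! ### The cyclotome `M_X` inside the maximal cuspidally central quotient -/

section Cyclotome

variable {E F : FundamentalExtension.{u}} (q : E ⟶ F)

/-- `N = Ker(Δ_{U_x} ↠ Δ_X)` is normal in `Π`. [cite: MochizukiAbsTopIII2015, Prop 1.4 (ii) p.31] -/
instance cuspidalKernel_normal : (cuspidalKernel q).Normal := by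
  unfold cuspidalKernel
  exact Subgroup.normal_inf_normal _ _

/-- `[N, Δ]⁻` is normal in `Π` (`N`, `Δ` are). [cite: MochizukiAbsTopIII2015, Prop 1.4 (ii) p.31] -/
instance cuspidallyCentralModulus_normal : (cuspidallyCentralModulus q).Normal := by
  unfold cuspidallyCentralModulus
  exact Subgroup.is_normal_topologicalClosure _

/-- "the maximal cuspidally central quotient" ambient group `Π_{U_x}/[N, Δ_{U_x}]⁻` (a
topological group). [cite: MochizukiAbsTopIII2015, Prop 1.4 (ii) p.31] -/
abbrev CuspidallyCentralQuotient : Type u := E.arith ⧸ cuspidallyCentralModulus q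

/-- The cyclotome `M_X`, realised as the image of `N = Ker(Δ_{U_x} ↠ Δ_X)` in
`Π_{U_x}/[N, Δ]⁻` — by Prop. 1.4 (ii) ("`1 → I_x → Δ^{c-cn}_{U_x} → Δ_X → 1`", "the natural
isomorphism `M_X ≅ I_x`") this is a copy of `I_x ≅ Ẑ(1)` with its `Π`-action.
[cite: MochizukiAbsTopIII2015, Prop 1.4 (ii) p.31] -/
def geomCyclotome : Subgroup (CuspidallyCentralQuotient q) :=
  (cuspidalKernel q).map (QuotientGroup.mk' (cuspidallyCentralModulus q))

/-- `M_X` is normal in `Π_{U_x}/[N, Δ]⁻`. [cite: MochizukiAbsTopIII2015, Prop 1.4 (ii) p.31] -/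
instance geomCyclotome_normal : (geomCyclotome q).Normal :=
  Subgroup.Normal.map inferInstance _ (QuotientGroup.mk'_surjective _)

/-- `M_X` is commutative: `[N, N] ≤ [N, Δ] ≤ [N, Δ]⁻` since `N ≤ Δ` ("`Ker(Q ↠ Δ_X)` lies in the
center of `Q`"). [cite: MochizukiAbsTopIII2015, Prop 1.4 (ii) p.31] -/
instance geomCyclotome_isMulCommutative : IsMulCommutative (geomCyclotome q) := by
  refine ⟨⟨fun a b => ?_⟩⟩
  obtain ⟨_, x, hx, rfl⟩ := a
  obtain ⟨_, y, hy, rfl⟩ := b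
  apply Subtype.ext
  change (QuotientGroup.mk' _ x) * (QuotientGroup.mk' _ y) =
    (QuotientGroup.mk' _ y) * (QuotientGroup.mk' _ x)
  rw [← map_mul, ← map_mul, QuotientGroup.mk'_apply, QuotientGroup.mk'_apply, QuotientGroup.eq]
  have hmem := Subgroup.commutator_mem_commutator (inv_mem hy) (inv_mem (Subgroup.mem_inf.mp hx).2)
  rw [commutatorElement_def, inv_inv, inv_inv] at hmem
  have h : (x * y)⁻¹ * (y * x) = y⁻¹ * x⁻¹ * y * x := by
    simp only [mul_inv_rev, mul_assoc]
  rw [h]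
  exact Subgroup.le_topologicalClosure _ hmem

end Cyclotome

/-! ### `H¹(Π_U, M_X)` via Mathlib's continuous cohomology -/

section H1

variable {E' E F : FundamentalExtension.{u}} (r : E' ⟶ E) (q : E ⟶ F)

/-- `Π_U → Π_{U_x} ↠ Π_{U_x}/[N, Δ]⁻`, through which `Π_U` acts on `M_X`.
[cite: MochizukiAbsTopIII2015, Prop 1.6 p.34] -/
def toCuspidallyCentralQuotient : E'.arith →* CuspidallyCentralQuotient q :=
  (QuotientGroup.mk' (cuspidallyCentralModulus q)).comp r.arith.toMonoidHom

/-- The `Π_U`-module `M_X` (Prop. 1.6 p. 34: "`H¹(Π_U, M_X)` — where `M_X ≅ Ẑ(1)` is as in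
Proposition 1.4, (ii)"), as a continuous `ℤ`-linear representation of `Π_U` (written additively).
[cite: MochizukiAbsTopIII2015, Prop 1.6 p.34] -/
def geomCyclotomeRep : ContRepresentation ℤ E'.arith (Additive (geomCyclotome q)) :=
  (conjRep (geomCyclotome q)).restrict (toCuspidallyCentralQuotient r q)

/-- `M_X` as an object of Mathlib's category `TopRep ℤ Π_U`. [cite: MochizukiAbsTopIII2015, Prop 1.6 p.34] -/
abbrev geomCyclotomeTopRep : TopRep.{u} ℤ E'.arith := TopRep.of (geomCyclotomeRep r q)

/-- `H¹(Π_U, M_X)`: Mathlib's continuous cohomology (homogeneous continuous cochains) in degree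
one of the `Π_U`-module `M_X` — a topological `ℤ`-module (REAL).
[cite: MochizukiAbsTopIII2015, Prop 1.6 p.34] -/
abbrev geomCyclotomeH1 : TopModuleCat.{u} ℤ := continuousCohomology.{0, u, u} 1 (geomCyclotomeTopRep r q)

/-- The inclusion of a subgroup as a continuous homomorphism.
[cite: MochizukiAbsTopIII2015, Prop 1.6 (iii) p.35] -/
def subgroupInclusion (D : Subgroup E'.arith) : D →ₜ* E'.arith :=
  { toMonoidHom := D.subtype, continuous_toFun := continuous_subtype_val }

/-- Restriction `H¹(Π_U, M_X) → H¹(D, M_X)` to a subgroup `D ≤ Π_U` ("restricting cohomology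
classes of `Π_U` to the various `I_x`", Prop. 1.6 (iii) p. 35; "`η|_{x_i} := s_{x_i}^*(η)`",
Prop. 1.8 (i) p. 36) — Mathlib's `ContinuousCohomology.map` along the inclusion.
[cite: MochizukiAbsTopIII2015, Prop 1.6 (iii) p.35] -/
def geomCyclotomeH1Res (D : Subgroup E'.arith) :
    geomCyclotomeH1 r q ⟶ continuousCohomology.{0, u, u} 1 (TopRep.res (subgroupInclusion D : D →* E'.arith)
      (geomCyclotomeTopRep r q)) :=
  ContinuousCohomology.map.{0, u, u} (subgroupInclusion D) (𝟙 _) 1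

end H1

/-! ### Proposition 1.6 relative to a model with Kummer data -/

/-- A `CurveModel` together with the GEOMETRIC Kummer data of Prop. 1.6 p. 34: the regular
units "`Γ(U, 𝒪_U^×)`" inside `K_U^×` and "the associated Kummer map
`κ_U : Γ(U, 𝒪_U^×) → H¹(Π_U, M_X)`" for every presentation `U ⊆ U_x ⊆ X` by cofinite opens
(the target `H¹(Π_U, M_X)` is the REAL group `H1 (res h₁) (res h₂)` above; the map itself is
geometric, [Mzk19] §2). [cite: MochizukiAbsTopIII2015, Prop 1.6 p.34] -/
structure KummerCurveModel : Type (u + 2) extends CurveModel.{u} where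
  /-- "`Γ(U, 𝒪_U^×)`" as a subgroup of `K_U^×` -/
  regularUnits : ∀ U : Curve, Subgroup (FunctionField U)ˣ
  /-- "the associated Kummer map `κ_U : Γ(U, 𝒪_U^×) → H¹(Π_U, M_X)`" -/
  kummer : ∀ {U Ux X : Curve} (h₁ : IsCofiniteOpen U Ux) (h₂ : IsCofiniteOpen Ux X),
    regularUnits U →* Multiplicative (geomCyclotomeH1 (res h₁) (res h₂))

namespace CurveModel

/-- A presentation `U_x ⊆ X` and a cusp `x` of `U_x` for which `geomCyclotome (M.res h)` IS the
cyclotome `M_X` of Prop. 1.4 (ii): `X` proper, `x` rational with free procyclic inertia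
("`x ∈ X(k) ∖ U(k)`", "`I_x ≅ Ẑ(1)`"), `U_x = X ∖ {x}` (the cuspidal kernel is generated by
`I_x`, Prop. 1.4 (i)), and the sequence `1 → I_x → Δ^{c-cn}_{U_x} → Δ_X → 1` is exact
(Prop. 1.4 (ii)). [cite: MochizukiAbsTopIII2015, Prop 1.4 (ii) p.31] -/
@[mk_iff] structure IsCyclotomePresentation (M : CurveModel.{u}) {Ux X : M.Curve}
    (h : M.IsCofiniteOpen Ux X) (x : (M.cusps Ux).Cusp) : Prop where
  /-- `U_x` and `X` are scheme-like curves (Prop. 1.4 is about curves, §1 p. 29) -/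
  isScheme : M.IsScheme Ux ∧ M.IsScheme X
  /-- `X` is proper -/
  isProper : M.IsProper X
  /-- `x ∈ X(k)` -/
  isRational : (M.cusps Ux).IsRational x
  /-- `I_x ≅ Ẑ` -/
  isFreeProcyclic : FundamentalExtension.IsFreeProcyclic ((M.cusps Ux).Icusp x)
  /-- `U_x = X ∖ {x}`: the cuspidal kernel is the closed normal closure of `I_x` -/
  kernel_eq : cuspidalKernel (M.res h) =
    (Subgroup.normalClosure ((M.cusps Ux).Icusp x : Set (M.ext Ux).arith)).topologicalClosure
  /-- Prop. 1.4 (ii): `1 → I_x → Δ^{c-cn}_{U_x} → Δ_X → 1` is exact -/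
  isCuspidallyCentral : IsCuspidallyCentralExtension (M.res h) ((M.cusps Ux).Icusp x)

end CurveModel

/-- Prop. 1.6 (i), relative to a model with Kummer data: "suppose further that `k` is a
Kummer-faithful field. [...] (i) The Kummer map `κ_U` is injective" — for every presentation
`U ⊆ U_x ⊆ X` in which `geomCyclotome` is the cyclotome of `X` (`IsCyclotomePresentation`).
NAMED FACT relative to `M` (hypothesis `IsKummerFaithful`: TODO(general form), see
`KummerFaithful.lean`). [cite: MochizukiAbsTopIII2015, Prop 1.6 (i) p.34] -/
def Prop_1_6_i (M : KummerCurveModel.{u}) : Prop :=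
  ∀ (U Ux X : M.Curve) (h₁ : M.IsCofiniteOpen U Ux) (h₂ : M.IsCofiniteOpen Ux X)
    (x : (M.cusps Ux).Cusp), M.IsScheme U → M.IsCyclotomePresentation h₂ x →
    IsKummerFaithful (M.base U) →
    Function.Injective (M.kummer h₁ h₂)

/-- Prop. 1.6 (iii), the part statable without the Picard schemes, relative to `M`: from
"restricting cohomology classes of `Π_U` to the various `I_x` [...] yields a natural exact
sequence `1 → (k^×)^∧ → H¹(Π_U, M_X) → ⊕_{x ∈ S} Ẑ`" and "the image of `Γ(U, 𝒪_U^×)` in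
`H¹(Π_U, M_X)/(k^×)^∧` is [...] determined by the principal divisors" (setting: "`U = X ∖ S`, where
`S ⊆ X(k)` is a finite subset", i.e. ALL cusps of `U` rational) one gets: a regular unit
`f ∈ Γ(U, 𝒪_U^×)` has trivial restriction to EVERY cuspidal inertia group of `U` iff `f` is a
constant.  PARTIAL typing of (iii) (the identification `Hom(I_x, M_X) ≅ Ẑ` and `(k^×)^∧` itself
are not typed).  NAMED FACT relative to `M`. [cite: MochizukiAbsTopIII2015, Prop 1.6 (iii) p.35] -/
def Prop_1_6_iii_units (M : KummerCurveModel.{u}) : Prop :=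
  ∀ (U Ux X : M.Curve) (h₁ : M.IsCofiniteOpen U Ux) (h₂ : M.IsCofiniteOpen Ux X)
    (x : (M.cusps Ux).Cusp), M.IsScheme U → M.IsCyclotomePresentation h₂ x →
    IsKummerFaithful (M.base U) →
    (∀ c : (M.cusps U).Cusp, (M.cusps U).IsRational c) →
    ∀ f : M.regularUnits U,
      (∀ c : (M.cusps U).Cusp,
          (geomCyclotomeH1Res (M.res h₁) (M.res h₂) ((M.cusps U).Icusp c)) (Multiplicative.toAdd (M.kummer h₁ h₂ f))
            = 0)
        ↔ ((f : (M.FunctionField U)ˣ) : M.FunctionField U)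
            ∈ Set.range (algebraMap (M.base U) (M.FunctionField U))

/-! ### Proposition 1.8 for Kummer classes of regular units (PARTIAL) -/

/-- Prop. 1.8 (i) p. 36 ("In the situation of Proposition 1.6, (iii)": all cusps of `U` rational),
SPECIAL CASE `η = κ_U(f)`, `f ∈ Γ(U, 𝒪_U^×)` (these classes lie in `P_U` by Prop. 1.6 (iii)): "`η ∈ P_U` is the Kummer class of a nonconstant NF-rational function if and
only if there exist a positive multiple `η†` of `η` and NF-points `x₁, x₂ ∈ U(k_x)` [...] such
that [...] `η†|_{x₁} = 0`, `η†|_{x₂} ≠ 0`" — restrictions to the decomposition groups `D_{x_i}`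
of the model.  PARTIAL typing (general `η ∈ P_U` needs `P_U`, i.e. the synchronizations
`I_z ≅ M_X`); NAMED FACT relative to `M`. [cite: MochizukiAbsTopIII2015, Prop 1.8 (i) p.36] -/
def Prop_1_8_i_units (M : KummerCurveModel.{u}) : Prop :=
  ∀ (U Ux X : M.Curve) (h₁ : M.IsCofiniteOpen U Ux) (h₂ : M.IsCofiniteOpen Ux X)
    (x : (M.cusps Ux).Cusp), M.IsScheme U → M.IsCyclotomePresentation h₂ x →
    IsKummerFaithful (M.base U) →
    (∀ c : (M.cusps U).Cusp, (M.cusps U).IsRational c) →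
    M.IsNFCurve U → ∀ f : M.regularUnits U,
      (M.IsNFRational U ((f : (M.FunctionField U)ˣ) : M.FunctionField U)
          ∧ ((f : (M.FunctionField U)ˣ) : M.FunctionField U)
              ∉ Set.range (algebraMap (M.base U) (M.FunctionField U)))
        ↔ ∃ n : ℕ, 0 < n ∧ ∃ x₁ x₂ : M.Point U, M.IsNFPoint U x₁ ∧ M.IsNFPoint U x₂ ∧
            (geomCyclotomeH1Res (M.res h₁) (M.res h₂) (M.decomp U x₁))
                (n • Multiplicative.toAdd (M.kummer h₁ h₂ f)) = 0
              ∧ (geomCyclotomeH1Res (M.res h₁) (M.res h₂) (M.decomp U x₂))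
                (n • Multiplicative.toAdd (M.kummer h₁ h₂ f)) ≠ 0

/-- Prop. 1.8 (ii) p. 36 ("In the situation of Proposition 1.6, (iii)": all cusps of `U` rational),
SPECIAL CASE `η = κ_U(c)` for a constant regular unit `c ∈ k^×`:
"Suppose that there exist nonconstant NF-rational functions `∈ Γ(U, 𝒪_U^×)`. Then a class
`η ∈ P_U ∩ H¹(G_k, M_X)` is the Kummer class of an NF-constant `∈ k^×` if and only if there exist
a nonconstant NF-rational function `f ∈ Γ(U, 𝒪_U^×)` and an NF-point `x ∈ U(k_x)` [...] such
that `κ_U(f)|_x = η|_{G_{k_x}}`" — restrictions to `D_x`.  PARTIAL typing; NAMED FACT relative to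
`M`. [cite: MochizukiAbsTopIII2015, Prop 1.8 (ii) p.36] -/
def Prop_1_8_ii_units (M : KummerCurveModel.{u}) : Prop :=
  ∀ (U Ux X : M.Curve) (h₁ : M.IsCofiniteOpen U Ux) (h₂ : M.IsCofiniteOpen Ux X)
    (x : (M.cusps Ux).Cusp), M.IsScheme U → M.IsCyclotomePresentation h₂ x →
    IsKummerFaithful (M.base U) →
    (∀ c : (M.cusps U).Cusp, (M.cusps U).IsRational c) →
    M.IsNFCurve U →
    (∃ g : M.regularUnits U, M.IsNFRational U ((g : (M.FunctionField U)ˣ) : M.FunctionField U)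
        ∧ ((g : (M.FunctionField U)ˣ) : M.FunctionField U)
            ∉ Set.range (algebraMap (M.base U) (M.FunctionField U))) →
    ∀ (c : (M.base U)ˣ) (hc : Units.map (algebraMap (M.base U) (M.FunctionField U) : _ →* _) c
        ∈ M.regularUnits U),
      M.IsNFConstant U (c : M.base U) ↔
        ∃ (f : M.regularUnits U) (y : M.Point U),
          M.IsNFRational U ((f : (M.FunctionField U)ˣ) : M.FunctionField U)
            ∧ ((f : (M.FunctionField U)ˣ) : M.FunctionField U)
                ∉ Set.range (algebraMap (M.base U) (M.FunctionField U))
            ∧ M.IsNFPoint U y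
            ∧ (geomCyclotomeH1Res (M.res h₁) (M.res h₂) (M.decomp U y)) (Multiplicative.toAdd (M.kummer h₁ h₂ f))
                = (geomCyclotomeH1Res (M.res h₁) (M.res h₂) (M.decomp U y))
                    (Multiplicative.toAdd (M.kummer h₁ h₂ ⟨_, hc⟩))

end Literature.AnabelianGeometry.AbsoluteAnabelian.AbsTopIII
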